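import Mathlib.RingTheory.Nullstellensatz
import Mathlib.RingTheory.Polynomial.UniqueFactorization
import Summits.MatrixMultiplication.MatrixMultiplication.Theorems.ObstructionDescentUniversalOccurrenceHypersurfaceLaw

set_option linter.dupNamespace false
set_option autoImplicit false

/-!
# Universal occurrence from the hypersurface EQUATION — the set-theoretic form of the blindness law (decomp-mm · lens 3 · gen 40)

Support for the crux `NoOccurrenceObstruction` of `route-MatrixMultiplication-ObstructionDescent` through the
universal-occurrence ladder `u(N)`; nothing here enters `closes`.

`uocc_of_hypersurface_invariant` (this generation, `…HypersurfaceLaw`) concludes `UOCC(r,N)` from a prime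
`SL_N³`-invariant form `F` of degree `Nδ` with `k_N(δ) ≥ 2`, under the IDEAL-THEORETIC hypothesis that every Borel
weight vector vanishing on `Σ_r := {t : algBorderRank t ≤ r}` is divisible by `F`.  Here that hypothesis is
DERIVED from the SET-THEORETIC one
`Z(F) ⊆ Σ_r`, i.e. `F(t) = 0 ⟹ algBorderRank t ≤ r` ("the zeros of `F` have border rank `≤ r`"),
by Hilbert's Nullstellensatz over `ℂ` (`MvPolynomial.vanishingIdeal_zeroLocus_eq_radical`) and primality:
`f|_{Σ_r} = 0 ⟹ f|_{Z(F)} = 0 ⟹ f ∈ √(F) ⟹ F ∣ fⁿ ⟹ F ∣ f` (`dvd_of_forall_aeval_eq_zero`,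
`dvd_of_vanishing_on_algBorderRank_le`).  Only the inclusion `Z(F) ⊆ Σ_r` is used, never `Σ_r ⊆ Z(F)`; and since
`ℂ[x]` is factorial, `Prime F` may be read `Irreducible F`.

Consequences: `uocc_of_hypersurface_equation` (general `(r; N,N,N)`), and at the unique non-defective cubic
hypersurface format `(18; 7,7,7)` (`7³ − 1 = 18·19`): `uocc_eighteen_seven_of_equation` —
UOCC(18,7) ⟸ { an irreducible `SL₇³`-invariant form `F` of degree `7δ` all of whose zeros have border rank `≤ 18` }
 + { `k_7(6) ≥ 2 ∧ k_7(7) ≥ 2` (computed: 438744, 125250433) | `δ ≥ 8` (`…_of_eight_le`) }.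
The remaining dictionary is thus exactly: "`σ₁₈(ℂ⁷⊗ℂ⁷⊗ℂ⁷) = {algBorderRank ≤ 18}` is an irreducible hypersurface,
hence the zero set of one irreducible form, which is `SL₇³`-invariant" [cite: BurgisserClausenShokrollahi1997, Thm. 20.3,
Lemma 20.10] [cite: Lickteig1985] [cite: BurgisserIkenmeyer2017, §5, Lemma 5.1].

All statements are `theorem`s; no `def`, no `sorry`.
-/

open scoped BigOperators

namespace Summit.MatrixMultiplication.MatrixMultiplication.Theorems.ObstructionCalculus

open Literature.Computability.AlgebraicComplexity (kroneckerPow isotypicSum₁ isotypicSum₂ isotypicSum₃ unitTensor algBorderRank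
  sl3InvariantsOfDegree kronRect)

/-! ## §1 Nullstellensatz step: vanishing on the zeros of a prime form means divisibility -/

/-- **Prime Nullstellensatz.** Over `ℂ` with finitely many variables: if `f` vanishes at every zero of the prime
polynomial `F`, then `F ∣ f` (`f ∈ I(Z(F)) = √(F)`, so `F ∣ fⁿ`, so `F ∣ f`). [bookkeeping] -/
theorem dvd_of_forall_aeval_eq_zero {σ : Type*} [Finite σ] {F f : MvPolynomial σ ℂ} (hp : Prime F)
    (h : ∀ x : σ → ℂ, MvPolynomial.aeval x F = 0 → MvPolynomial.aeval x f = 0) : F ∣ f := by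
  have hf : f ∈ MvPolynomial.vanishingIdeal ℂ (MvPolynomial.zeroLocus ℂ (Ideal.span {F})) := by
    rw [MvPolynomial.mem_vanishingIdeal_iff]
    intro x hx
    exact h x ((MvPolynomial.mem_zeroLocus_iff.1 hx) F (Ideal.mem_span_singleton_self F))
  rw [MvPolynomial.vanishingIdeal_zeroLocus_eq_radical] at hf
  obtain ⟨n, hn⟩ := Ideal.mem_radical_iff.1 hf
  exact hp.dvd_of_dvd_pow (Ideal.mem_span_singleton.1 hn)

/-- The same with `Irreducible F` (`ℂ[x_σ]` is a unique factorisation domain). [bookkeeping] -/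
theorem dvd_of_forall_aeval_eq_zero_of_irreducible {σ : Type*} [Finite σ] {F f : MvPolynomial σ ℂ}
    (hF : Irreducible F) (h : ∀ x : σ → ℂ, MvPolynomial.aeval x F = 0 → MvPolynomial.aeval x f = 0) : F ∣ f :=
  dvd_of_forall_aeval_eq_zero (UniqueFactorizationMonoid.irreducible_iff_prime.1 hF) h

variable {N : ℕ}

/-- Every point of the affine space `ℂ^{N×N×N}` is (the coordinate vector of) a tensor: evaluation of the calculus at the
tensor `(i,j,k) ↦ x (i,j,k)` is `aeval x`. [bookkeeping] -/
theorem evalT_curry_eq_aeval (x : Idx N → ℂ) (f : MvPolynomial (Idx N) ℂ) :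
    evalT (fun i j k => x (i, j, k)) f = MvPolynomial.aeval x f := rfl

/-- **From the equation to the ideal.** If every zero of the prime form `F` has border rank `≤ r`, then every polynomial
vanishing on `{t : algBorderRank t ≤ r}` is divisible by `F`. [bookkeeping] -/
theorem dvd_of_vanishing_on_algBorderRank_le {r : ℕ} {F f : MvPolynomial (Idx N) ℂ} (hp : Prime F)
    (hZ : ∀ t : Tensor ℂ N, evalT t F = 0 → algBorderRank t ≤ r)
    (hf : ∀ t : Tensor ℂ N, algBorderRank t ≤ r → evalT t f = 0) : F ∣ f := by
  refine dvd_of_forall_aeval_eq_zero hp fun x hx => ?_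
  rw [← evalT_curry_eq_aeval] at hx ⊢
  exact hf _ (hZ _ hx)

/-! ## §2 Universal occurrence from the equation of a secant hypersurface -/

/-- **Blindness from the equation.** Let `0 < N ≤ r` and let `F` be a prime homogeneous `SL_N³`-invariant of degree `Nδ` on
`ℂ^N⊗ℂ^N⊗ℂ^N` all of whose zeros have border rank `≤ r`, with `k_N(δ) ≥ 2`.  Then `UOCC(r,N)`: every type occurring for a
tensor of format `≤ N` occurs for the unit tensor `⟨r⟩` — the hypersurface `Z(F) ⊆ σ_r` carries no occurrence obstruction.
(K20 `uocc_of_hypersurface_invariant` + the prime Nullstellensatz.) [cite: BurgisserIkenmeyer2017, §5] -/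
theorem uocc_of_hypersurface_equation {r δ : ℕ} (hN : 0 < N) (hNr : N ≤ r) {F : MvPolynomial (Idx N) ℂ}
    (hF : F ∈ sl3InvariantsOfDegree (Fin N) ℂ (N * δ)) (hp : Prime F) (h2 : 2 ≤ kronRect ℂ N δ)
    (hZ : ∀ t : Tensor ℂ N, evalT t F = 0 → algBorderRank t ≤ r) :
    ∀ {ι : Type} [Fintype ι], Fintype.card ι ≤ N → ∀ (s : ι → ι → ι → ℂ) (d : ℕ) (lam : Fin 3 → Nat.Partition d),
      isotypicSum₁ (lam 0) (isotypicSum₂ (lam 1) (isotypicSum₃ (lam 2) (kroneckerPow s d))) ≠ 0 →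
      isotypicSum₁ (lam 0) (isotypicSum₂ (lam 1) (isotypicSum₃ (lam 2) (kroneckerPow (unitTensor ℂ r) d))) ≠ 0 :=
  @fun _ _ hι => uocc_of_hypersurface_invariant hN hNr hF hp h2
    (fun _ _ _ _ hf => dvd_of_vanishing_on_algBorderRank_le hp hZ hf) hι

/-- `uocc_of_hypersurface_equation` with `Irreducible F`. [bookkeeping] -/
theorem uocc_of_hypersurface_equation_of_irreducible {r δ : ℕ} (hN : 0 < N) (hNr : N ≤ r) {F : MvPolynomial (Idx N) ℂ}
    (hF : F ∈ sl3InvariantsOfDegree (Fin N) ℂ (N * δ)) (hirr : Irreducible F) (h2 : 2 ≤ kronRect ℂ N δ)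
    (hZ : ∀ t : Tensor ℂ N, evalT t F = 0 → algBorderRank t ≤ r) :
    ∀ {ι : Type} [Fintype ι], Fintype.card ι ≤ N → ∀ (s : ι → ι → ι → ℂ) (d : ℕ) (lam : Fin 3 → Nat.Partition d),
      isotypicSum₁ (lam 0) (isotypicSum₂ (lam 1) (isotypicSum₃ (lam 2) (kroneckerPow s d))) ≠ 0 →
      isotypicSum₁ (lam 0) (isotypicSum₂ (lam 1) (isotypicSum₃ (lam 2) (kroneckerPow (unitTensor ℂ r) d))) ≠ 0 :=
  uocc_of_hypersurface_equation hN hNr hF (UniqueFactorizationMonoid.irreducible_iff_prime.1 hirr) h2 hZ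

/-! ## §3 The format `(18; 7,7,7)` -/

/-- **`UOCC(18,7)` from the equation of `σ₁₈(ℂ⁷⊗ℂ⁷⊗ℂ⁷)`.**  If `F` is an irreducible `SL₇³`-invariant form of degree `7δ`
all of whose zeros have border rank `≤ 18` — the equation of the secant hypersurface `σ₁₈ = {algBorderRank ≤ 18}`
(`dim = 342 = 343 − 1`, irreducible [cite: BurgisserClausenShokrollahi1997, Thm. 20.3, Lemma 20.10] [cite: Lickteig1985]) is
such an `F` — and the two Kronecker atoms `k_7(6) ≥ 2`, `k_7(7) ≥ 2` hold (computed exactly: 438744 and 125250433;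
`k_7(6)` also [cite: AmanovYeliussizov2022, §9 Table 4]), then every type occurring for some tensor of format `≤ 7` occurs
for `⟨18⟩`, although the generic `7×7×7` tensor has border rank `19`: `u(7) ≤ 18 < 19 = R_gen(7)`. -/
theorem uocc_eighteen_seven_of_equation {δ : ℕ} {F : MvPolynomial (Idx 7) ℂ}
    (hF : F ∈ sl3InvariantsOfDegree (Fin 7) ℂ (7 * δ)) (hirr : Irreducible F)
    (hZ : ∀ t : Tensor ℂ 7, evalT t F = 0 → algBorderRank t ≤ 18)
    (h6 : 2 ≤ kronRect ℂ 7 6) (h7 : 2 ≤ kronRect ℂ 7 7) :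
    ∀ {ι : Type} [Fintype ι], Fintype.card ι ≤ 7 → ∀ (s : ι → ι → ι → ℂ) (d : ℕ) (lam : Fin 3 → Nat.Partition d),
      isotypicSum₁ (lam 0) (isotypicSum₂ (lam 1) (isotypicSum₃ (lam 2) (kroneckerPow s d))) ≠ 0 →
      isotypicSum₁ (lam 0) (isotypicSum₂ (lam 1) (isotypicSum₃ (lam 2) (kroneckerPow (unitTensor ℂ 18) d))) ≠ 0 :=
  @fun _ _ hι => uocc_eighteen_seven_of_hypersurface hF (UniqueFactorizationMonoid.irreducible_iff_prime.1 hirr)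
    (fun _ _ _ _ hf => dvd_of_vanishing_on_algBorderRank_le (UniqueFactorizationMonoid.irreducible_iff_prime.1 hirr) hZ hf)
    h6 h7 hι

/-- The same with the atoms replaced by the degree bound `deg F = 7δ ≥ 56` (`k_7(δ) ≥ 14` for `δ ≥ 8`,
`fourteen_le_kronRect_seven_of_eight_le`); numerically `I_d(σ₁₈(7³)) = 0` for `d ≤ 186999`
[cite: HauensteinIkenmeyerLandsberg2013] [cite: Landsberg2017, §8.3.2]. -/
theorem uocc_eighteen_seven_of_equation_of_eight_le {δ : ℕ} (hδ : 8 ≤ δ) {F : MvPolynomial (Idx 7) ℂ}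
    (hF : F ∈ sl3InvariantsOfDegree (Fin 7) ℂ (7 * δ)) (hirr : Irreducible F)
    (hZ : ∀ t : Tensor ℂ 7, evalT t F = 0 → algBorderRank t ≤ 18) :
    ∀ {ι : Type} [Fintype ι], Fintype.card ι ≤ 7 → ∀ (s : ι → ι → ι → ℂ) (d : ℕ) (lam : Fin 3 → Nat.Partition d),
      isotypicSum₁ (lam 0) (isotypicSum₂ (lam 1) (isotypicSum₃ (lam 2) (kroneckerPow s d))) ≠ 0 →
      isotypicSum₁ (lam 0) (isotypicSum₂ (lam 1) (isotypicSum₃ (lam 2) (kroneckerPow (unitTensor ℂ 18) d))) ≠ 0 :=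
  uocc_of_hypersurface_equation_of_irreducible (by norm_num) (by norm_num) hF hirr
    (le_trans (by norm_num) (fourteen_le_kronRect_seven_of_eight_le hδ)) hZ

end Summit.MatrixMultiplication.MatrixMultiplication.Theorems.ObstructionCalculus
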